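import Mathlib.CategoryTheory.Groupoid
import Mathlib.CategoryTheory.Functor.FullyFaithful
import Mathlib.Data.Set.Image
import Literature.IUT.HodgeTheaters.Conventions
import HarnessLib

/-!
# [IUTchI] §0 poly-isomorphisms: functoriality and fullness lemmas (supplement to `Conventions.lean`)

Mochizuki, *Inter-universal Teichmüller Theory I*, kurims manuscript (May 2020), §0 "Notations and
Conventions", p. 33 (D-0012 claim key, status disputed; every decl carries
`[claim: Mochizuki2012, status: disputed]`; the content is elementary category theory and takes no side).

Printed text (p. 33): "we define a poly-morphism `A → B` to be a collection of morphisms `A → B` …; if all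
of the morphisms in the collection are isomorphisms, then we shall refer to the poly-morphism as a
poly-isomorphism … We define the full poly-isomorphism `A ⥲ B` to be the poly-morphism given by the
collection of all isomorphisms `A ⥲ B`. The composite of a poly-morphism `{f_i : A → B}_{i∈I}` with a
poly-morphism `{g_j : B → C}_{j∈J}` is defined to be the poly-morphism given by the set [i.e., where
"multiplicities" are ignored] `{g_j ∘ f_i : A → C}_{(i,j)∈I×J}`." Throughout [IUTchI–III] poly-isomorphisms
are pushed along "functorial algorithms" ("… induces a poly-isomorphism …", e.g. [IUTchIII] Prop 1.2 (i)
p.31) and full poly-isomorphisms are composed (e.g. [IUTchII] Cor 4.10 (iv) p.160, [IUTchIII] Thm 1.5).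

This file SUPPLEMENTS the canonical `Literature.IUT.HodgeTheaters.PolyIso` of `Conventions.lean`
(abc-iut-L5-t1; L6 dedup ruling D2, 2026-08-25T18:31Z: one FQN per notion) with the lemmas the
[IUTchIII] §1–§2 files of `Literature/IUT/LogThetaLattice/` consume, under the OWNER's namespace so that
no second `PolyIso` exists: `PolyIso.single`, `PolyIso.map` (image under a functor), `mem_full`,
`mem_comp`, `comp_full_of_nonempty` / `full_comp_of_nonempty` (composites with a full poly-isomorphism
are full), `map_full_of_fullyFaithful` / `map_full_of_full` (a fully faithful functor, resp. a full
functor out of a groupoid, maps the full poly-isomorphism ONTO the full poly-isomorphism — the use made of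
[IUTchI] Cor 5.3 (ii)/(iii)), `symm_full`. Filed by abc-iut-L6-t3 in the owner's directory by agreement
with ruling D2 ("lemmas Conventions lacks go to L5-t1's file"; `Conventions.lean` is at its line budget).
-/

namespace Literature.IUT.HodgeTheaters

open CategoryTheory

universe v u v' u'

namespace PolyIso

variable {C : Type u} [Category.{v} C] {A B D : C}

/-- **IUTchI:§0** (kurims p.33) the poly-isomorphism consisting of a single isomorphism.
[claim: Mochizuki2012, status: disputed] -/
def single (f : A ≅ B) : PolyIso A B := {f}

/-- **IUTchI:§0** (kurims p.33) membership in `single`. [claim: Mochizuki2012, status: disputed] -/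
@[simp] theorem mem_single {f g : A ≅ B} : g ∈ single f ↔ g = f := Set.mem_singleton_iff

/-- **IUTchI:§0** (kurims p.33) every isomorphism belongs to the full poly-isomorphism.
[claim: Mochizuki2012, status: disputed] -/
@[simp] theorem mem_full (f : A ≅ B) : f ∈ full A B := Set.mem_univ f

/-- **IUTchI:§0** (kurims p.33) membership in a composite: "`{g_j ∘ f_i}`".
[claim: Mochizuki2012, status: disputed] -/
theorem mem_comp {P : PolyIso A B} {Q : PolyIso B D} {h : A ≅ D} :
    h ∈ P.comp Q ↔ ∃ f ∈ P, ∃ g ∈ Q, f ≪≫ g = h := Set.mem_image2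

/-- **IUTchI:§0** (kurims p.33) "induces a poly-isomorphism": the image of a poly-isomorphism under a
functor (functorial algorithm). [claim: Mochizuki2012, status: disputed] -/
def map {D' : Type u'} [Category.{v'} D'] (G : C ⥤ D') (P : PolyIso A B) : PolyIso (G.obj A) (G.obj B) :=
  G.mapIso '' P

/-- **IUTchI:§0** (kurims p.33) membership in the image poly-isomorphism. [claim: Mochizuki2012, status: disputed] -/
theorem mem_map {D' : Type u'} [Category.{v'} D'] {G : C ⥤ D'} {P : PolyIso A B} {e : G.obj A ≅ G.obj B} :
    e ∈ P.map G ↔ ∃ f ∈ P, G.mapIso f = e := Set.mem_image _ _ _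

/-- **IUTchI:§0** (kurims p.33) the image of `single f` is `single (G f)`. [claim: Mochizuki2012, status: disputed] -/
@[simp] theorem map_single {D' : Type u'} [Category.{v'} D'] (G : C ⥤ D') (f : A ≅ B) :
    (single f).map G = single (G.mapIso f) := Set.image_singleton

/-- **IUTchI:§0** (kurims p.33) a nonempty poly-isomorphism has nonempty image. [claim: Mochizuki2012, status: disputed] -/
theorem Nonempty.map {D' : Type u'} [Category.{v'} D'] (G : C ⥤ D') {P : PolyIso A B} (hP : P.Nonempty) :
    (P.map G).Nonempty := hP.image _

/-- **IUTchI:§0** (kurims p.33) composing a nonempty poly-isomorphism with the full one gives the full one.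
[claim: Mochizuki2012, status: disputed] -/
theorem comp_full_of_nonempty {P : PolyIso A B} (hP : P.Nonempty) : P.comp (full B D) = full A D := by
  ext h
  simp only [mem_comp, mem_full, true_and, iff_true]
  obtain ⟨f, hf⟩ := hP
  exact ⟨f, hf, f.symm ≪≫ h, by simp⟩

/-- **IUTchI:§0** (kurims p.33) composing the full poly-isomorphism with a nonempty one gives the full one.
[claim: Mochizuki2012, status: disputed] -/
theorem full_comp_of_nonempty {Q : PolyIso B D} (hQ : Q.Nonempty) : (full A B).comp Q = full A D := by
  ext h
  simp only [mem_comp, mem_full, true_and, iff_true]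
  obtain ⟨g, hg⟩ := hQ
  exact ⟨h ≪≫ g.symm, g, hg, by simp⟩

/-- **IUTchI:§0** (kurims p.33) the inverse of the full poly-isomorphism is the full poly-isomorphism.
[claim: Mochizuki2012, status: disputed] -/
theorem symm_full : (full A B).symm = full B A := by
  ext h
  simp only [symm, full, Set.image_univ, Set.mem_range, Set.mem_univ, iff_true]
  exact ⟨h.symm, h.symm_symm_eq⟩

/-- **IUTchI:Cor5.3(ii)** (kurims p.144) a FULLY FAITHFUL functor maps the full poly-isomorphism ONTO the full
poly-isomorphism ("the natural map `Isom(¹F, ²F) → Isom(¹D, ²D)` is bijective").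
[claim: Mochizuki2012, status: disputed] -/
theorem map_full_of_fullyFaithful {D' : Type u'} [Category.{v'} D'] {G : C ⥤ D'} (hG : G.FullyFaithful)
    (A B : C) : (full A B).map G = full (G.obj A) (G.obj B) := by
  ext e
  simp only [map, full, Set.image_univ, Set.mem_range, Set.mem_univ, iff_true]
  exact ⟨hG.preimageIso e, hG.isoEquiv.apply_symm_apply e⟩

/-- **IUTchI:Cor5.3(iii)** (kurims p.144) a FULL functor out of a groupoid maps the full poly-isomorphism ONTO
the full poly-isomorphism ("the natural map `Isom(¹F^⊢, ²F^⊢) → Isom(¹D^⊢, ²D^⊢)` is surjective").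
[claim: Mochizuki2012, status: disputed] -/
theorem map_full_of_full {C₀ : Type u} [Groupoid.{v} C₀] {D' : Type u'} [Category.{v'} D'] {G : C₀ ⥤ D'}
    [G.Full] (A B : C₀) : (full A B).map G = full (G.obj A) (G.obj B) := by
  ext e
  simp only [map, full, Set.image_univ, Set.mem_range, Set.mem_univ, iff_true]
  exact ⟨asIso (G.preimage e.hom), Iso.ext (by simp)⟩

/-- **IUTchI:§0** (kurims p.33) images compose: `(P.map G).map H = P.map (G ⋙ H)`.
[claim: Mochizuki2012, status: disputed] -/
theorem map_map {D' : Type u'} [Category.{v'} D'] {E : Type*} [Category E] (G : C ⥤ D') (H : D' ⥤ E)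
    (P : PolyIso A B) : (P.map G).map H = P.map (G ⋙ H) := by
  ext e
  simp only [mem_map]
  constructor
  · rintro ⟨_, ⟨f, hf, rfl⟩, rfl⟩
    exact ⟨f, hf, rfl⟩
  · rintro ⟨f, hf, rfl⟩
    exact ⟨G.mapIso f, ⟨f, hf, rfl⟩, rfl⟩

/-- **IUTchI:§0** (kurims p.33) functors preserve composites of poly-isomorphisms up to inclusion (equality
holds; the inclusion is what is used). [claim: Mochizuki2012, status: disputed] -/
theorem map_comp_subset {D' : Type u'} [Category.{v'} D'] (G : C ⥤ D') (P : PolyIso A B) (Q : PolyIso B D) :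
    (P.comp Q).map G ⊆ (P.map G).comp (Q.map G) := by
  rintro _ ⟨h, ⟨f, hf, g, hg, rfl⟩, rfl⟩
  exact ⟨G.mapIso f, ⟨f, hf, rfl⟩, G.mapIso g, ⟨g, hg, rfl⟩, (G.mapIso_trans f g).symm⟩

end PolyIso

end Literature.IUT.HodgeTheaters
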